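import Summits.CriticalPhenomena.PercolationContinuityZ3.Theorems.PercNearOneGluingNoHeavyRsw3InvasionLocality
import HarnessLib

/-!
# RSW3 lane (P1, gen 33): INVASION PERCOLATION — locality of the stopped invasion with respect to the FINITE set of graph edges
# touching `Λ` (the form consumed by the independence lemma of the label space)

builds on p205010 (kernel theorem, internal audit signed; external expert review pending) — NOT used in this file.

Cell `prim-rsw3`, prover seat `prim-rsw3-p1` (gen 33), sequel scoping memo `run/shared/lean/prim/rsw3/SEQUEL-MSF.md` §3 (R5) / §4 F5, F8:
the N4 elaboration test ("`𝓩^{i-1}` is measurable with respect to the state of edges in `B̄_{m_{i-1}}`", NTW 2017 p. 19).  Support file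
(`--supports stmt-CriticalPhenomena-4575`); no definitions, no named facts, no sorries.

p2's locality file (`…Rsw3InvasionLocality`, CCN §3) proves that the invasion up to its break-out of a finite set `Λ` is unchanged when the
label field is modified off the pairs `e` with `∃ x ∈ Λ, x ∈ e` — an INFINITE set of pairs `s(x, y)` (all `y`).  The independence lemma
of the label space (`GrimmettMarstrand1990.labelMeasure_real_inter_preimage_eq_mul`) and the sub-σ-algebras of the renewal step
(`NTW17.ae_frequently_mem_labelMeasure`) want FINITE sets of coordinates.  Since the invasion only ever reads the labels of GRAPH edges
(boundary darts are adjacent pairs), the same proofs give locality with respect to the finite set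
`E_Λ = Λ.biUnion (fun x => (G.neighborFinset x).image fun y => s(x, y))` of edges of `G` touching `Λ`:

* `minDarts_congr_of_agree_adj`, `newDart_congr_of_agree_adj`, `invasion_congr_of_agree_adj` (`n ≤ n_Λ`),
  `acceptedLabel_congr_of_agree_adj` (`n < n_Λ`), `exitIndex_congr_of_agree_adj`, `exitVertex_congr_of_agree_adj`,
  `invasion_exitIndex_congr_of_agree_adj` — agreement hypothesis `∀ x ∈ Λ, ∀ y, G.Adj x y → U s(x,y) = U' s(x,y)`;
* `agree_adj_of_forall_mem_edgesTouching` — that hypothesis from agreement on the finset `E_Λ`;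
* **`determined_stoppedInvasion`** — every property of the stopped invasion `I_{n_Λ}` is DETERMINED by the labels of `E_Λ` (the
  hypothesis shape of `NTW17.measurableSet_comap_restrict_of_determined`), and `measurable_stoppedInvasion_prop` — it is a measurable event.

References: J. T. Chayes, L. Chayes, C. M. Newman, Comm. Math. Phys. 101 (1985) §3 (proof of Thm 3.2: "the event … depends only on the
values assigned to those bonds with both endpoints in `Λ_m`") [ChayesChayesNewman1985]; C. M. Newman, V. Tassion, W. Wu, CPAM 70 (2017),
arXiv:1512.09107 §4 p. 19 [NewmanTassionWu2017].
-/

noncomputable section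

namespace Summit.CriticalPhenomena.PercolationContinuityZ3.Theorems.Rsw3

open Finset MeasureTheory Literature.Probability.Percolation Literature.Probability.Percolation.Invasion

variable {V : Type*} [DecidableEq V] {G : SimpleGraph V} [G.LocallyFinite]

/-! ## Locality with respect to the graph edges touching `Λ` -/

/-- Two label fields that agree on the GRAPH edges touching `Λ` have the same minimising darts from any region `I ⊆ Λ`.
[cite: ChayesChayesNewman1985, §3 proof of Thm 3.2 (the break-out event depends only on the bonds of Λ_m)] -/
theorem minDarts_congr_of_agree_adj {U U' : Sym2 V → ℝ} {Λ I : Finset V} (hI : I ⊆ Λ)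
    (h : ∀ x ∈ Λ, ∀ y, G.Adj x y → U s(x, y) = U' s(x, y)) : minDarts G U I = minDarts G U' I := by
  have hlab : ∀ b ∈ boundaryDarts G I, U s(b.1, b.2) = U' s(b.1, b.2) := fun b hb =>
    h b.1 (hI ((mem_boundaryDarts G).1 hb).1) b.2 ((mem_boundaryDarts G).1 hb).2.2
  ext a
  simp only [mem_minDarts]
  constructor
  · rintro ⟨ha, hmin⟩
    exact ⟨ha, fun b hb => by rw [← hlab a ha, ← hlab b hb]; exact hmin b hb⟩
  · rintro ⟨ha, hmin⟩
    exact ⟨ha, fun b hb => by rw [hlab a ha, hlab b hb]; exact hmin b hb⟩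

/-- Hence the same absorbed dart. [cite: ChayesChayesNewman1985, §3 proof of Thm 3.2] -/
theorem newDart_congr_of_agree_adj {U U' : Sym2 V → ℝ} {Λ I : Finset V} (hI : I ⊆ Λ)
    (h : ∀ x ∈ Λ, ∀ y, G.Adj x y → U s(x, y) = U' s(x, y)) : newDart G U I = newDart G U' I :=
  newDart_congr G (minDarts_congr_of_agree_adj hI h)

/-- **Locality of the invasion up to break-out, graph-edge form**: if `U` and `U'` agree on the graph edges touching `Λ`, then
`I_n(U) = I_n(U')` for every `n ≤ n_Λ(U)`. [cite: ChayesChayesNewman1985, §3 proof of Thm 3.2] -/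
theorem invasion_congr_of_agree_adj {U U' : Sym2 V → ℝ} {o : V} {Λ : Finset V} (hex : ∃ n, ¬ invasion G U o n ⊆ Λ)
    (h : ∀ x ∈ Λ, ∀ y, G.Adj x y → U s(x, y) = U' s(x, y)) {n : ℕ} (hn : n ≤ exitIndex G U o Λ) :
    invasion G U o n = invasion G U' o n := by
  induction n with
  | zero => rfl
  | succ n ih =>
    have hsub : invasion G U o n ⊆ Λ := (exitIndex_spec G hex).2 n (Nat.lt_of_succ_le hn)
    rw [invasion_succ, invasion_succ, ← ih (Nat.le_of_succ_le hn)]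
    cases hd : newDart G U (invasion G U o n) with
    | none =>
      rw [step_of_eq_none G hd, step_of_eq_none G]
      rwa [← newDart_congr_of_agree_adj hsub h]
    | some a =>
      rw [step_of_eq_some G hd, step_of_eq_some G]
      rwa [← newDart_congr_of_agree_adj hsub h]

/-- Locality of the accepted labels before break-out (graph-edge form). [cite: ChayesChayesNewman1985, §3 proof of Thm 3.2] -/
theorem acceptedLabel_congr_of_agree_adj {U U' : Sym2 V → ℝ} {o : V} {Λ : Finset V} (hex : ∃ n, ¬ invasion G U o n ⊆ Λ)
    (h : ∀ x ∈ Λ, ∀ y, G.Adj x y → U s(x, y) = U' s(x, y)) {n : ℕ} (hn : n < exitIndex G U o Λ) :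
    acceptedLabel G U o n = acceptedLabel G U' o n := by
  have hsub : invasion G U o n ⊆ Λ := (exitIndex_spec G hex).2 n hn
  have hI : invasion G U o n = invasion G U' o n := invasion_congr_of_agree_adj hex h hn.le
  cases hd : newDart G U (invasion G U o n) with
  | none =>
    have hd' : newDart G U' (invasion G U' o n) = none := by rwa [← hI, ← newDart_congr_of_agree_adj hsub h]
    simp only [acceptedLabel, hd, hd']
  | some a =>
    have hd' : newDart G U' (invasion G U' o n) = some a := by rwa [← hI, ← newDart_congr_of_agree_adj hsub h]
    rw [acceptedLabel_of_eq_some G hd, acceptedLabel_of_eq_some G hd']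
    exact h a.1 (hsub (fst_mem_of_newDart hd)) a.2 (adj_of_newDart hd)

/-- Locality of the break-out time (graph-edge form). [cite: ChayesChayesNewman1985, §3 proof of Thm 3.2] -/
theorem exitIndex_congr_of_agree_adj {U U' : Sym2 V → ℝ} {o : V} {Λ : Finset V} (hex : ∃ n, ¬ invasion G U o n ⊆ Λ)
    (h : ∀ x ∈ Λ, ∀ y, G.Adj x y → U s(x, y) = U' s(x, y)) : exitIndex G U' o Λ = exitIndex G U o Λ := by
  obtain ⟨hN, hlt⟩ := exitIndex_spec G hex
  have hN' : ¬ invasion G U' o (exitIndex G U o Λ) ⊆ Λ := by rwa [← invasion_congr_of_agree_adj hex h le_rfl]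
  rw [exitIndex_eq_iff G ⟨_, hN'⟩]
  exact ⟨hN', fun n hn => by rw [← invasion_congr_of_agree_adj hex h hn.le]; exact hlt n hn⟩

/-- The break-out event transfers (graph-edge form): if `U` leaves `Λ`, so does `U'`. [cite: ChayesChayesNewman1985, §3 proof of Thm 3.2] -/
theorem exists_not_subset_of_agree_adj {U U' : Sym2 V → ℝ} {o : V} {Λ : Finset V} (hex : ∃ n, ¬ invasion G U o n ⊆ Λ)
    (h : ∀ x ∈ Λ, ∀ y, G.Adj x y → U s(x, y) = U' s(x, y)) : ∃ n, ¬ invasion G U' o n ⊆ Λ := by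
  refine ⟨exitIndex G U o Λ, ?_⟩
  rw [← invasion_congr_of_agree_adj hex h le_rfl]
  exact (exitIndex_spec G hex).1

/-- **Locality of the STOPPED invasion** (graph-edge form): `I_{n_Λ(U')}(U') = I_{n_Λ(U)}(U)` — NTW's `𝓘_x^m` is a function of the
labels of the graph edges touching `Λ_m`. [cite: NewmanTassionWu2017, §4 (proof of Thm 2.4, p. 19: "measurable with respect to the state of edges in B̄_{m_{i-1}}")] -/
theorem invasion_exitIndex_congr_of_agree_adj {U U' : Sym2 V → ℝ} {o : V} {Λ : Finset V}
    (hex : ∃ n, ¬ invasion G U o n ⊆ Λ) (h : ∀ x ∈ Λ, ∀ y, G.Adj x y → U s(x, y) = U' s(x, y)) :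
    invasion G U' o (exitIndex G U' o Λ) = invasion G U o (exitIndex G U o Λ) := by
  rw [exitIndex_congr_of_agree_adj hex h]
  exact (invasion_congr_of_agree_adj hex h le_rfl).symm

/-- Locality of the break-out vertex (graph-edge form), when `o ∈ Λ`. [cite: ChayesChayesNewman1985, §3 proof of Thm 3.2] -/
theorem exitVertex_congr_of_agree_adj {U U' : Sym2 V → ℝ} {o : V} {Λ : Finset V} (ho : o ∈ Λ)
    (hex : ∃ n, ¬ invasion G U o n ⊆ Λ) (h : ∀ x ∈ Λ, ∀ y, G.Adj x y → U s(x, y) = U' s(x, y)) :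
    exitVertex G U' o Λ = exitVertex G U o Λ := by
  have hpos : 0 < exitIndex G U o Λ := by
    rcases Nat.eq_zero_or_pos (exitIndex G U o Λ) with h0 | h0
    · exact absurd (by rw [h0, invasion_zero]; exact singleton_subset_iff.2 ho) (exitIndex_spec G hex).1
    · exact h0
  have hlt : exitIndex G U o Λ - 1 < exitIndex G U o Λ := Nat.sub_lt hpos one_pos
  have hsub : invasion G U o (exitIndex G U o Λ - 1) ⊆ Λ := (exitIndex_spec G hex).2 _ hlt
  have hI : invasion G U o (exitIndex G U o Λ - 1) = invasion G U' o (exitIndex G U' o Λ - 1) := by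
    rw [exitIndex_congr_of_agree_adj hex h]; exact invasion_congr_of_agree_adj hex h hlt.le
  have hD : newDart G U (invasion G U o (exitIndex G U o Λ - 1)) =
      newDart G U' (invasion G U' o (exitIndex G U' o Λ - 1)) := by
    rw [← hI]; exact newDart_congr_of_agree_adj hsub h
  simp only [exitVertex, hD]

/-! ## The finite set of graph edges touching `Λ` -/

/-- Agreement on the finset `E_Λ = ⋃_{x ∈ Λ} {s(x, y) : y ∼ x}` of graph edges touching `Λ` gives the agreement hypothesis of the
locality lemmas above. [folklore] -/
theorem agree_adj_of_forall_mem_edgesTouching {U U' : Sym2 V → ℝ} {Λ : Finset V}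
    (h : ∀ e ∈ Λ.biUnion (fun x => (G.neighborFinset x).image fun y => s(x, y)), U e = U' e) :
    ∀ x ∈ Λ, ∀ y, G.Adj x y → U s(x, y) = U' s(x, y) := fun x hx y hxy =>
  h _ (Finset.mem_biUnion.2 ⟨x, hx, Finset.mem_image.2 ⟨y, (SimpleGraph.mem_neighborFinset G x y).2 hxy, rfl⟩⟩)

/-- **Every property of the stopped invasion is DETERMINED by the labels of the finite set `E_Λ` of graph edges touching `Λ`**
(when the invasion leaves `Λ` for every label field, e.g. on an infinite connected graph): the hypothesis shape of
`NTW17.measurableSet_comap_restrict_of_determined` / `labelMeasure_real_inter_preimage_eq_mul`.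
[cite: NewmanTassionWu2017, §4 (proof of Thm 2.4, p. 19)] -/
theorem determined_stoppedInvasion {o : V} {Λ : Finset V} (hall : ∀ U : Sym2 V → ℝ, ∃ n, ¬ invasion G U o n ⊆ Λ)
    (P : Finset V → Prop) :
    ∀ U U' : Sym2 V → ℝ, (∀ e ∈ Λ.biUnion (fun x => (G.neighborFinset x).image fun y => s(x, y)), U e = U' e) →
      P (invasion G U o (exitIndex G U o Λ)) → P (invasion G U' o (exitIndex G U' o Λ)) := by
  intro U U' h hP
  rwa [invasion_exitIndex_congr_of_agree_adj (hall U) (agree_adj_of_forall_mem_edgesTouching h)]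

/-- On an infinite preconnected graph the invasion leaves every finite set, for every label field (p2's `exists_not_subset_invasion`),
so `determined_stoppedInvasion` applies unconditionally. [cite: ChayesChayesNewman1985, §2 (the model)] -/
theorem determined_stoppedInvasion_of_preconnected [Infinite V] (hG : G.Preconnected) (o : V) (Λ : Finset V)
    (P : Finset V → Prop) :
    ∀ U U' : Sym2 V → ℝ, (∀ e ∈ Λ.biUnion (fun x => (G.neighborFinset x).image fun y => s(x, y)), U e = U' e) →
      P (invasion G U o (exitIndex G U o Λ)) → P (invasion G U' o (exitIndex G U' o Λ)) :=
  determined_stoppedInvasion (fun U => exists_not_subset_invasion hG U o Λ) P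

/-- Every property of the stopped invasion defines a measurable event of the label space. [cite: ChayesChayesNewman1985, §3 proof of Thm 3.2] -/
theorem measurable_stoppedInvasion_prop [Countable V] (o : V) (Λ : Finset V) (P : Finset V → Prop) :
    Measurable fun U : Sym2 V → ℝ => P (invasion G U o (exitIndex G U o Λ)) := by
  have : (fun U : Sym2 V → ℝ => P (invasion G U o (exitIndex G U o Λ))) =
      fun U => ∃ N : ℕ, exitIndex G U o Λ = N ∧ P (invasion G U o N) := by
    ext U
    exact ⟨fun h => ⟨_, rfl, h⟩, fun ⟨N, hN, h⟩ => by rw [hN]; exact h⟩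
  rw [this]
  exact Measurable.exists fun N => (measurable_exitIndex_eq o Λ N).and (measurable_invasion_prop o N P)

end Summit.CriticalPhenomena.PercolationContinuityZ3.Theorems.Rsw3
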